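import Summits.Ventures.CertifiedArithmetic.Expansions.WeakExpansionGrow

/-!
# Weakly nonoverlapping expansions, part 10 (§14): Theorem 5, closure under EXPANSION-SUM

HONEST FRAMING (ENGINES group, unit `eng-quad-4`, kernels lane of the `certquad` engine — shared
numerical engines serving client cells; rigour lives in the verifiers; every published number
belongs to a client cell's ledger, not to the engines group): NEW WORK of the lane's Lean line, not a
published result, hence under `Summits/Ventures/` with no citation tag; nothing here is cited anywhere
as a literature fact.  Parts 1–9 (`WeakExpansion*.lean`: the class W = `IsWeakExpansion`, Theorems 1–2
on FAST-EXPANSION-SUM, Theorem 3 on SCALE-EXPANSION, Theorem 4 on GROW-EXPANSION) precede.  This file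
introduces no definitions.

THEOREM 5 (`expansionSum_isWeakExpansion`, `…_roundTiesEven`).  For any precision `p ≥ 1` and any
round-to-nearest rounding whose roundoff is 2-below its result (`RoundoffBelow 2`, e.g. IEEE
round-half-even): if `e` (m components) and `f` (n components) are weakly nonoverlapping expansions of
floats then `h = EXPANSION-SUM(e, f)` (Shewchuk's Figure 7: `⟨h₁,…,hᵢ₋₁, window⟩ ← GROW-EXPANSION
(window, fᵢ)` for `i = 1 … n`) is a weakly nonoverlapping expansion of `m + n` floats with
`Σ hᵢ = Σ eᵢ + Σ fᵢ`.  Shewchuk's Theorem 12 gives this for the class "nonoverlapping" (any tie rule)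
and, for round-to-even, "nonadjacent"; the class W lies strictly between, so with parts 6, 8 and 9 ALL
FOUR of Shewchuk's addition / scaling algorithms (GROW-EXPANSION, EXPANSION-SUM, FAST-EXPANSION-SUM for
`p ≥ 4`, SCALE-EXPANSION) map the class W into itself under round-half-even — the class is a usable
working invariant, unlike "nonoverlapping" (not preserved by FAST-EXPANSION-SUM:
`FastExpansionSumCounterexample.lean`) and "strongly nonoverlapping" (not preserved by SCALE-EXPANSION:
`ScaleExpansionCounterexample.lean`).  Evidence gathered before the proof
(informal Python enumeration in the exact rational model, evidence only): exhaustive, `e`, `f` weakly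
nonoverlapping with bounded gaps over the relevant exponent window — `p = 3`, ≤ 2 + ≤ 2 components,
226 176 pairs; `p = 2`, ≤ 3 + ≤ 2 components, 198 992 pairs; random adjacency-biased pairs — `p = 4`,
≤ 7 + ≤ 7 components, 50 000 pairs; `p = 5`, ≤ 6 + ≤ 6 components, 30 000 pairs: 0 failures under
round-to-even.  (Under round-half-away already GROW-EXPANSION fails, part 9.)

PROOF (§14.2, induction on `f` with a varying window, as in Theorem 12).  Write
`(Q, h₁) = TWO-SUM(f₁, e₁)`, `E' = GROW-EXPANSION(⟨e₂,…⟩, Q)` (the new window, weakly nonoverlapping by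
Theorem 4) and `R = EXPANSION-SUM(E', ⟨f₂,…⟩)` (weakly nonoverlapping by induction), so that
`h = h₁ :: R`.  As in Theorem 12, `h₁` is 1-below everything in `R` (common grid); and it is 2-below
everything in `R` unless it is CRITICAL: `|h₁| = |e₁| = 2^a` with `e₁` adjacent to a later window
component, or `|h₁| = |f₁| = 2^a` with `f₁` adjacent to a later `fⱼ`.  A critical `h₁` is a one-bit
number, hence weakly below everything; the only danger is a double adjacency `h₁ | y | z` inside
`h₁ :: R`, which needs `y = ±2^(a+1)` adjacent to a later `z` in `R`.  The induction carries the LEVELS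
INVARIANT (§14.1, `expansionSum_weak_levels`): an output one-bit component adjacent to a later output
records an adjacency AT THE SAME LEVEL of the window or of `f` — levels of `E'` are levels of
`⟨e₂,…⟩` (`level_of_growExpansion`, from part 9's `growExpansion_pairwise_levels`).  So level `a + 1`
is an adjacency level of `e` or of `f`, next to the level `a` recorded by `h₁`: the same list cannot
carry both (part 7, `IsWeakExpansion.not_two_levels`), and the CROSS cases are excluded by magnitude —
at a critical emission the other operand is a nonzero multiple of `2^(a+1)`
(`two_zpow_succ_le_of_critical`: `Q ∈ 2^(a+2)ℤ` by `RoundoffBelow 2` and `h₁ = ±` the critical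
operand), so every later component of ITS list is a multiple of `2^(a+2)` and none is `±2^(a+1)`
(`no_level_above`).
-/

namespace Summit.Ventures.CertifiedArithmetic.Expansions

open Literature.ComputerArithmetic.JeannerodRump2018
open Literature.ComputerArithmetic.BoldoJeannerodMelquiondMuller2023 hiding twoSum twoSum_fst isFloat_twoSum
open Literature.ComputerArithmetic.Shewchuk1997

variable {p : ℕ} {emin : ℤ} {fl : ℚ → ℚ}

/-! ### §14.1  Adjacency levels -/

/-- "Has an adjacency at level `a`" (a one-bit component `±2^a` not 2-below some later component, in
the negated-`Pairwise` form of parts 7–9) passes from a tail to the whole list. -/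
theorem level_cons {P : ℚ → ℚ → Prop} (x : ℚ) {xs : List ℚ} (h : ¬ xs.Pairwise P) :
    ¬ (x :: xs).Pairwise P := fun hpw => h (List.pairwise_cons.mp hpw).2

/-- **The adjacency levels of `GROW-EXPANSION(es, Q)` are adjacency levels of `es`**: an output
one-bit component `±2^a` adjacent to a later output is a critical output of the loop, which records an
adjacency of the input at the same level (part 9, `growExpansion_pairwise_levels`). -/
theorem level_of_growExpansion (hp : 1 ≤ p) (hfl : IsRoundNearest p emin fl)
    (hfl2 : RoundoffBelow 2 fl) {es : List ℚ} {Q : ℚ} (hQ : IsFloat p emin Q)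
    (hes : ∀ x ∈ es, IsFloat p emin x) (hW : es.Pairwise WeakBelow) {a : ℤ}
    (h : ¬ (growExpansion fl es Q).Pairwise fun x y => |x| = (2 : ℚ) ^ a → Below 2 x y) :
    ¬ es.Pairwise fun x y => |x| = (2 : ℚ) ^ a → Below 2 x y := by
  intro hes_a
  refine h ((growExpansion_pairwise_levels hp hfl hfl2 es Q hQ hes hW).imp ?_)
  intro u v huv hua
  rcases huv with h2 | ⟨-, a', hua', hlev⟩
  · exact h2
  · exfalso
    rw [add_zero, hua] at hua'
    have haa : a = a' := zpow_right_injective₀ (by norm_num) (by norm_num) hua'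
    exact hlev (haa ▸ hes_a)

/-- A list whose components are pairwise weakly below satisfies the levels relation against its own
adjacency levels. -/
theorem pairwise_levels_self : ∀ {l : List ℚ}, l.Pairwise WeakBelow →
    l.Pairwise fun u v => Below 2 u v ∨ (Below 1 u v ∧ ∃ a : ℤ, |u| = (2 : ℚ) ^ a ∧
      ¬ l.Pairwise fun x y => |x| = (2 : ℚ) ^ a → Below 2 x y)
  | [], _ => List.Pairwise.nil
  | x :: xs, h => by
    obtain ⟨hx, hxs⟩ := List.pairwise_cons.mp h
    refine List.pairwise_cons.mpr ⟨fun y hy => ?_, (pairwise_levels_self hxs).imp ?_⟩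
    · by_cases h2 : Below 2 x y
      · exact Or.inl h2
      · rcases hx y hy with h2' | ⟨h1, a, hxa⟩
        · exact absurd h2' h2
        · exact Or.inr ⟨h1, a, hxa, fun hpw => h2 ((List.pairwise_cons.mp hpw).1 y hy hxa)⟩
    · exact fun huv => huv.imp_right fun ⟨h1, a, hua, hlev⟩ => ⟨h1, a, hua, level_cons x hlev⟩

/-- **No adjacency level just above a large component.**  If every component of `l` is 1-above `x`
and `2^(a+1) ≤ |x|`, then no component of `l` is a one-bit number `±2^(a+1)`, so `l` has no adjacency
at level `a + 1`. -/
theorem no_level_above {x : ℚ} {l : List ℚ} {a : ℤ} (hl : ∀ y ∈ l, Below 1 x y)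
    (hx : (2 : ℚ) ^ (a + 1) ≤ |x|) :
    l.Pairwise fun u v => |u| = (2 : ℚ) ^ (a + 1) → Below 2 u v := by
  refine List.Pairwise.imp_of_mem (R := fun _ _ => True) ?_
    (List.pairwise_of_forall fun _ _ => trivial)
  intro u v hu _ _ hua
  exfalso
  obtain ⟨s, huG, hlt⟩ := hl u hu
  have hu0 : u ≠ 0 := abs_pos.mp (by rw [hua]; exact zpow_pos (by norm_num) _)
  have h1 : (2 : ℚ) ^ s ≤ |u| := huG.two_zpow_le_abs hu0
  rw [one_mul] at hlt
  rw [hua] at h1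
  linarith

/-- **At a critical emission the other operand is large.**  If the roundoff `h = x + y − fl(x + y)`
of two floats is 2-below `fl(x + y)` and `|h| = |x| = 2^a`, then `2^(a+1) ≤ |y|`: indeed
`fl(x + y) ∈ 2^(a+2)ℤ`, `h = ±x`, so `y = fl(x + y) + (h − x) ∈ 2^(a+1)ℤ`, and `y ≠ 0` since
otherwise `h = x − fl(x) = 0`. -/
theorem two_zpow_succ_le_of_critical (hfl : IsRoundNearest p emin fl) {x y h : ℚ} {a : ℤ}
    (hx : IsFloat p emin x) (hh : h = x + y - fl (x + y)) (hB : Below 2 h (fl (x + y)))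
    (hha : |h| = (2 : ℚ) ^ a) (hhx : |h| = |x|) : (2 : ℚ) ^ (a + 1) ≤ |y| := by
  have h2 : (2 : ℚ) ≠ 0 := by norm_num
  obtain ⟨s, hQs, hlt⟩ := hB
  rw [hha, show (2 : ℚ) * 2 ^ a = 2 ^ (a + 1) by rw [zpow_add_one₀ h2]; ring] at hlt
  have hs : a + 1 < s := (zpow_lt_zpow_iff_right₀ (by norm_num : (1 : ℚ) < 2)).mp hlt
  have hQ : OnGrid (a + 1) (fl (x + y)) := hQs.mono hs.le
  have hd : OnGrid (a + 1) (h - x) := by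
    rcases abs_eq_abs.mp hhx with hhx' | hhx'
    · rw [hhx', sub_self]; exact OnGrid.zero _
    · apply onGrid_of_abs_eq_two_zpow
      rw [hhx', show -x - x = -(2 * x) by ring, abs_neg, abs_mul, abs_two, ← hhx, hha,
        zpow_add_one₀ h2, mul_comm]
  have hy : OnGrid (a + 1) y := by
    have : y = fl (x + y) + (h - x) := by rw [hh]; ring
    rw [this]; exact hQ.add hd
  have hy0 : y ≠ 0 := by
    rintro rfl
    rw [add_zero, fl_eq_self hfl hx, sub_self] at hh
    rw [hh, abs_zero] at hha
    exact (zpow_pos (by norm_num : (0 : ℚ) < 2) a).ne hha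
  exact hy.two_zpow_le_abs hy0

/-! ### §14.2  The levels invariant of EXPANSION-SUM and Theorem 5 -/

/-- **EXPANSION-SUM on weak inputs, roundoff 2-below: weak output, with the levels invariant.**  For
weakly nonoverlapping float lists `e` (the window) and `f`: `EXPANSION-SUM(e, f)` is weakly
nonoverlapping, AND every output `u` is, against every later output `v`, either 2-below `v`, or
1-below `v` and a one-bit number `|u| = 2^a` for a level `a` at which `e` or `f` has an adjacency. -/
theorem expansionSum_weak_levels (hp : 1 ≤ p) (hfl : IsRoundNearest p emin fl)
    (hfl2 : RoundoffBelow 2 fl) :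
    ∀ (f e : List ℚ), (∀ x ∈ e, IsFloat p emin x) → (∀ x ∈ f, IsFloat p emin x) →
      IsWeakExpansion e → IsWeakExpansion f →
      IsWeakExpansion (expansionSum fl e f) ∧
        (expansionSum fl e f).Pairwise fun u v => Below 2 u v ∨ (Below 1 u v ∧ ∃ a : ℤ,
          |u| = (2 : ℚ) ^ a ∧
            (¬ (e.Pairwise fun x y => |x| = (2 : ℚ) ^ a → Below 2 x y) ∨
              ¬ (f.Pairwise fun x y => |x| = (2 : ℚ) ^ a → Below 2 x y))) := by
  have h2 : (2 : ℚ) ≠ 0 := by norm_num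
  intro f
  induction f with
  | nil =>
    intro e _ _ heW _
    rw [expansionSum_nil_right]
    exact ⟨heW, (pairwise_levels_self heW.1).imp fun huv => huv.imp_right
      fun ⟨h1, a, hua, hlev⟩ => ⟨h1, a, hua, Or.inl hlev⟩⟩
  | cons f fs ih =>
    intro e heF hfF' heW hfW
    obtain ⟨hfF, hfsF⟩ := List.forall_mem_cons.mp hfF'
    obtain ⟨hf1, -, hfsW⟩ := isWeakExpansion_cons.mp hfW
    cases e with
    | nil =>
      rw [expansionSum_nil_left]
      exact ⟨hfW, (pairwise_levels_self hfW.1).imp fun huv => huv.imp_right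
        fun ⟨h1, a, hua, hlev⟩ => ⟨h1, a, hua, Or.inr hlev⟩⟩
    | cons e₁ es =>
      obtain ⟨he₁F, hesF⟩ := List.forall_mem_cons.mp heF
      obtain ⟨he1, -, hesW⟩ := isWeakExpansion_cons.mp heW
      rw [expansionSum_cons_cons]
      set Q₁ := (twoSum fl f e₁).1 with hQ₁def
      set h := (twoSum fl f e₁).2 with hhdef
      set E' := growExpansion fl es Q₁ with hE'def
      set R := expansionSum fl E' fs with hRdef
      have hQ₁fl : Q₁ = fl (f + e₁) := twoSum_fst fl f e₁
      have hh : h = f + e₁ - fl (f + e₁) := (twoSum_exact hp hfl hfF he₁F).1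
      have hQ₁F : IsFloat p emin Q₁ := (isFloat_twoSum hfl f e₁).1
      have hhQ : Below 2 h Q₁ := twoSum_below hp hfl hfl2 hfF he₁F
      have hh_le_e : |h| ≤ |e₁| := by
        rw [hh, abs_sub_comm]; exact (abs_err_add_le hfl hfF he₁F).2
      have hh_le_f : |h| ≤ |f| := by
        rw [hh, abs_sub_comm]; exact (abs_err_add_le hfl hfF he₁F).1
      have hE'F : ∀ x ∈ E', IsFloat p emin x := isFloat_of_mem_growExpansion hfl hQ₁F
      have hE'W : IsWeakExpansion E' := by
        have hg := (growExpansion_isWeakExpansion hp hfl hfl2 hfF heF heW).1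
        rw [growExpansion_cons] at hg
        exact (isWeakExpansion_cons.mp hg).2.2
      obtain ⟨hRW, hRL⟩ := ih E' hE'F hfsF hE'W hfsW
      -- adjacency levels of the new window are adjacency levels of the old one
      have hlevE : ∀ {a : ℤ}, ¬ (E'.Pairwise fun x y => |x| = (2 : ℚ) ^ a → Below 2 x y) →
          ¬ ((e₁ :: es).Pairwise fun x y => |x| = (2 : ℚ) ^ a → Below 2 x y) :=
        fun hl => level_cons e₁ (level_of_growExpansion hp hfl hfl2 hQ₁F hesF hesW.1 hl)
      have hRL' : R.Pairwise fun u v => Below 2 u v ∨ (Below 1 u v ∧ ∃ a : ℤ,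
          |u| = (2 : ℚ) ^ a ∧
            (¬ ((e₁ :: es).Pairwise fun x y => |x| = (2 : ℚ) ^ a → Below 2 x y) ∨
              ¬ ((f :: fs).Pairwise fun x y => |x| = (2 : ℚ) ^ a → Below 2 x y))) :=
        hRL.imp fun huv => huv.imp_right fun ⟨h1, a, hua, hlev⟩ =>
          ⟨h1, a, hua, hlev.imp hlevE (level_cons f)⟩
      -- the common grid (Theorem 12's engine): `h` c-below `Q₁`, the rest of the window and the
      -- rest of `f` ⇒ c-below everything produced later
      have closure : ∀ {c : ℚ}, Below c h Q₁ → (∀ y ∈ es, Below c h y) →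
          (∀ y ∈ fs, Below c h y) → ∀ z ∈ R, Below c h z := by
        intro c hcQ hes hfs z hz
        obtain ⟨k, hk, hQk, hck⟩ := hcQ.normalize hQ₁F
        have hlF : ∀ y ∈ es ++ fs, IsFloat p emin y := by
          intro y hy
          rcases List.mem_append.mp hy with hy | hy
          · exact hesF y hy
          · exact hfsF y hy
        have hlB : ∀ y ∈ es ++ fs, Below c h y := by
          intro y hy
          rcases List.mem_append.mp hy with hy | hy
          · exact hes y hy
          · exact hfs y hy
        obtain ⟨g, hg, hgk, hcg, hlG⟩ := exists_common_grid hlF hlB hk hck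
        have hesG : ∀ y ∈ es, OnGrid g y := fun y hy => hlG y (List.mem_append_left _ hy)
        have hfsG : ∀ y ∈ fs, OnGrid g y := fun y hy => hlG y (List.mem_append_right _ hy)
        have hWG : ∀ x ∈ E', OnGrid g x :=
          onGrid_of_mem_growExpansion hp hfl hg hQ₁F hesF (hQk.mono hgk) hesG
        exact ⟨g, onGrid_of_mem_expansionSum hp hfl hg hE'F hfsF hWG hfsG z hz, hcg⟩
      -- `h` is 1-below everything later, always (Theorem 12)
      have hall1 : ∀ z ∈ R, Below 1 h z :=
        closure (hhQ.anti (by norm_num))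
          (fun y hy => (he1 y hy).below_one.mono_left zero_le_one hh_le_e)
          (fun y hy => (hf1 y hy).below_one.mono_left zero_le_one hh_le_f)
      rw [isWeakExpansion_cons, List.pairwise_cons]
      by_cases hcrit : (|h| = |e₁| ∧ ∃ y₀ ∈ es, ¬ Below 2 e₁ y₀) ∨
          (|h| = |f| ∧ ∃ g₀ ∈ fs, ¬ Below 2 f g₀)
      swap
      · -- NON-CRITICAL emission: `h` is 2-below everything later
        have hb2 : ∀ {x : ℚ} {l : List ℚ}, |h| ≤ |x| → (∀ y ∈ l, WeakBelow x y) →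
            ¬ (|h| = |x| ∧ ∃ y₀ ∈ l, ¬ Below 2 x y₀) → ∀ y ∈ l, Below 2 h y := by
          intro x l hle hwb hn y hy
          rcases hwb y hy with hb | ⟨hb1, a, hxa⟩
          · exact hb.mono_left zero_le_two hle
          · by_cases hxy : Below 2 x y
            · exact hxy.mono_left zero_le_two hle
            have hne : |h| ≠ |x| := fun heq => hn ⟨heq, y, hy, hxy⟩
            have hlt : |h| < (2 : ℚ) ^ a := hxa ▸ lt_of_le_of_ne hle hne
            obtain ⟨s, hyG, hs⟩ := hb1
            rw [one_mul, hxa] at hs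
            have hs' : a + 1 ≤ s :=
              (zpow_lt_zpow_iff_right₀ (by norm_num : (1 : ℚ) < 2)).mp hs
            refine ⟨s, hyG, ?_⟩
            calc 2 * |h| < 2 * (2 : ℚ) ^ a := by linarith
              _ = (2 : ℚ) ^ (a + 1) := by rw [zpow_add_one₀ h2]; ring
              _ ≤ (2 : ℚ) ^ s := zpow_le_zpow_right₀ (by norm_num) hs'
        obtain ⟨hnE, hnF⟩ := not_or.mp hcrit
        have hall2 : ∀ z ∈ R, Below 2 h z :=
          closure hhQ (hb2 hh_le_e he1 hnE) (hb2 hh_le_f hf1 hnF)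
        exact ⟨⟨fun z hz => Or.inl (hall2 z hz),
          hRW.1.imp_of_mem fun {y _} hy _ _ => Or.inl (hall2 y hy), hRW⟩,
          fun z hz => Or.inl (hall2 z hz), hRL'⟩
      · -- CRITICAL emission: `|h| = 2^a`, a one-bit number 1-below everything later, recording an
        -- adjacency at level `a` of the window (`e`-critical) or of `f` (`f`-critical); in either
        -- case neither the REST of the window nor the rest of `f` has an adjacency at level `a + 1`
        obtain ⟨a, hha, hlev, hnoE, hnoF⟩ : ∃ a : ℤ, |h| = (2 : ℚ) ^ a ∧
            (¬ ((e₁ :: es).Pairwise fun x y => |x| = (2 : ℚ) ^ a → Below 2 x y) ∨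
              ¬ ((f :: fs).Pairwise fun x y => |x| = (2 : ℚ) ^ a → Below 2 x y)) ∧
            (es.Pairwise fun x y => |x| = (2 : ℚ) ^ (a + 1) → Below 2 x y) ∧
            (fs.Pairwise fun x y => |x| = (2 : ℚ) ^ (a + 1) → Below 2 x y) := by
          rcases hcrit with ⟨hhe, y₀, hy₀, hey₀⟩ | ⟨hhf, g₀, hg₀, hfg₀⟩
          · -- `e`-critical
            obtain ⟨a, hea⟩ : ∃ a : ℤ, |e₁| = (2 : ℚ) ^ a := by
              rcases he1 y₀ hy₀ with hb2 | ⟨-, ha⟩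
              · exact absurd hb2 hey₀
              · exact ha
            have hha : |h| = (2 : ℚ) ^ a := hhe.trans hea
            have hlevE' : ¬ ((e₁ :: es).Pairwise fun x y => |x| = (2 : ℚ) ^ a → Below 2 x y) :=
              fun hpw => hey₀ ((List.pairwise_cons.mp hpw).1 y₀ hy₀ hea)
            -- `f` is a nonzero multiple of `2^(a+1)`: no later `fⱼ` is `±2^(a+1)`
            have hfbig : (2 : ℚ) ^ (a + 1) ≤ |f| := by
              refine two_zpow_succ_le_of_critical hfl he₁F (y := f) ?_ ?_ hha hhe
              · rw [hh]; ring_nf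
              · rw [add_comm, ← hQ₁fl]; exact hhQ
            refine ⟨a, hha, Or.inl hlevE', ?_, no_level_above (fun y hy => (hf1 y hy).below_one) hfbig⟩
            by_contra hcon
            exact heW.not_two_levels hlevE' (level_cons e₁ hcon)
          · -- `f`-critical
            obtain ⟨a, hfa⟩ : ∃ a : ℤ, |f| = (2 : ℚ) ^ a := by
              rcases hf1 g₀ hg₀ with hb2 | ⟨-, ha⟩
              · exact absurd hb2 hfg₀
              · exact ha
            have hha : |h| = (2 : ℚ) ^ a := hhf.trans hfa
            have hlevF' : ¬ ((f :: fs).Pairwise fun x y => |x| = (2 : ℚ) ^ a → Below 2 x y) :=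
              fun hpw => hfg₀ ((List.pairwise_cons.mp hpw).1 g₀ hg₀ hfa)
            -- `e₁` is a nonzero multiple of `2^(a+1)`: no later window component is `±2^(a+1)`
            have hebig : (2 : ℚ) ^ (a + 1) ≤ |e₁| := by
              refine two_zpow_succ_le_of_critical hfl hfF (y := e₁) hh ?_ hha hhf
              rw [← hQ₁fl]; exact hhQ
            refine ⟨a, hha, Or.inr hlevF', no_level_above (fun y hy => (he1 y hy).below_one) hebig, ?_⟩
            by_contra hcon
            exact hfW.not_two_levels hlevF' (level_cons f hcon)
        refine ⟨⟨fun z hz => Or.inr ⟨hall1 z hz, a, hha⟩, ?_, hRW⟩,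
          fun z hz => Or.inr ⟨hall1 z hz, a, hha, hlev⟩, hRL'⟩
        -- no double adjacency `h | y | z`: an adjacent pair `y | z` of `R` with `y` adjacent to `h`
        -- would put an adjacency of the rest of the window or of the rest of `f` at level `a + 1`
        refine hRL.imp_of_mem fun {y z} hy _ hlyz => ?_
        by_cases hb2 : Below 2 h y
        · exact Or.inl hb2
        rcases hlyz with hyz2 | ⟨-, b, hyb, hlevb⟩
        · exact Or.inr hyz2
        have hb : b = a + 1 := eq_add_one_of_below_one_of_not_below_two (hall1 y hy) hb2 hha hyb
        subst hb
        exact (hlevb.elim (fun hl => level_of_growExpansion hp hfl hfl2 hQ₁F hesF hesW.1 hl hnoE)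
          (fun hl => hl hnoF)).elim

/-- **THEOREM 5 (closure of the class W under EXPANSION-SUM).**  For any precision `p ≥ 1` and any
round-to-nearest rounding whose roundoff is 2-below its result (`RoundoffBelow 2`, e.g. IEEE
round-half-even): if `e` (m components) and `f` (n components) are weakly nonoverlapping expansions
of floats then `h = EXPANSION-SUM(e, f)` is a weakly nonoverlapping expansion of `m + n` floats with
`Σ hᵢ = Σ eᵢ + Σ fᵢ`. -/
theorem expansionSum_isWeakExpansion (hp : 1 ≤ p) (hfl : IsRoundNearest p emin fl)
    (hfl2 : RoundoffBelow 2 fl) {e f : List ℚ} (he : ∀ x ∈ e, IsFloat p emin x)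
    (hf : ∀ x ∈ f, IsFloat p emin x) (hee : IsWeakExpansion e) (hff : IsWeakExpansion f) :
    IsWeakExpansion (expansionSum fl e f) ∧ (expansionSum fl e f).sum = e.sum + f.sum ∧
      (expansionSum fl e f).length = e.length + f.length ∧
      ∀ x ∈ expansionSum fl e f, IsFloat p emin x := by
  obtain ⟨-, hS, hlen, hFl⟩ :=
    expansionSum_nonoverlapping hp hfl he hf hee.isExpansion hff.isExpansion
  exact ⟨(expansionSum_weak_levels hp hfl hfl2 f e he hf hee hff).1, hS, hlen, hFl⟩

/-- **THEOREM 5 for IEEE round-half-even** (`roundTiesEven`, `p ≥ 1`): EXPANSION-SUM maps pairs of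
weakly nonoverlapping expansions to weakly nonoverlapping expansions. -/
theorem expansionSum_isWeakExpansion_roundTiesEven (hp : 1 ≤ p) {e f : List ℚ}
    (he : ∀ x ∈ e, IsFloat p emin x) (hf : ∀ x ∈ f, IsFloat p emin x)
    (hee : IsWeakExpansion e) (hff : IsWeakExpansion f) :
    IsWeakExpansion (expansionSum (roundTiesEven p emin) e f) ∧
      (expansionSum (roundTiesEven p emin) e f).sum = e.sum + f.sum ∧
      (expansionSum (roundTiesEven p emin) e f).length = e.length + f.length ∧
      ∀ x ∈ expansionSum (roundTiesEven p emin) e f, IsFloat p emin x :=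
  expansionSum_isWeakExpansion hp (isRoundNearest_roundTiesEven hp)
    (roundoffBelow_two_roundTiesEven p emin) he hf hee hff

end Summit.Ventures.CertifiedArithmetic.Expansions
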